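import Summits.AnomalousDissipation.AnomalousDissipation.Theses.TaylorCertificates

/-!
# Sketch — crux-ideate stmt-AnomalousDissipation-14030 (`TaylorCertificates.KolmogorovFloor`), round 1, ideator 2

Typed companions of this seat's two crux idea cards and one negative memo:
* §0 the crux unbundled per force (`FloorClassFor β f`, `KolmogorovFloorFor f`, `kolmogorovFloor_iff`);
* §1 card `dissipate-or-move-transport-dual`: `strainSup`, `budgetUnitBall`, `dualGauge`,
  FIRST LEMMA `BudgetLipschitz`, the transfer `DissipateOrMove` and its weak-duality link (stated);
* §2 card `k41-chain-kolmogorov-matching`: FIRST LEMMA `dyadic_chain_floor` (Mathlib-only real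
  inequality; the toy theorem behind the card), PROVED (0 sorry);
* §3 memo `WARM-RANGE-RAY.md`: `IsSteadyEulerField`, `IsLinearizedDesignerForce`, the kill
  `WarmRangeRayKill` (paper theorem, typed target) and the necessary condition it puts on the witness
  force (`witness_not_linearizedDesigner`, proved logic).
-/

noncomputable section

set_option linter.dupNamespace false

open MeasureTheory Filter Topology Finset
open scoped ENNReal BigOperators

namespace Summit.AnomalousDissipation.AnomalousDissipation.Cruxes.KolmogorovFloor.Ideator2

open Literature.Analysis.FunctionSpaces Literature.Analysis.FluidPDE
open Summit.AnomalousDissipation.AnomalousDissipation.Theses.TaylorCertificates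

/-- Local notation: the flat 3-torus. -/
local notation "𝕋³" => UnitAddTorus (Fin 3)
/-- Local notation: velocity values. -/
local notation "E³" => EuclideanSpace ℝ (Fin 3)
/-- Local notation: `L²(T³; ℝ³)`. -/
local notation "L2" => (Lp (EuclideanSpace ℝ (Fin 3)) 2 (volume : Measure (UnitAddTorus (Fin 3))))
/-- Local notation: the energy space `H`. -/
local notation "H3" => (Torus.energySpace (Fin 3))

/-! ## §0 The crux per force -/

/-- The FLOOR inequality of the crux at one state `u ∈ H` (verbatim body). -/
def FloorIneq (ν : ℝ) (f : 𝕋³ → E³) (Φ₁ : Torus.CylindricalTest (Fin 3)) (θ₁ ε₀ : ℝ) (u : H3) : Prop :=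
  let uf : 𝕋³ → E³ := ((u : L2) : 𝕋³ → E³)
  let D : ℝ := ν * (Torus.eGradNormSq uf).toReal
  let P : ℝ := Torus.pairing (u : L2) f - D
  Torus.eGradNormSq uf ≠ ⊤ → ‖u‖ ^ 2 ≤ 16 * (∫ x, ‖f x‖ ^ 2) / ν ^ 2 →
    ε₀ ≤ D + Torus.nsGeneratorPairing ν f u (Φ₁.grad u) + 2 * θ₁ * P

/-- The band-limited floor class of exponent `β` for a FIXED force `f` (the crux has `β = 3/4`). -/
def FloorClassFor (β : ℝ) (f : 𝕋³ → E³) : Prop :=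
  ∃ (ε₀ C Θ ν₀ : ℝ), 0 < ε₀ ∧ 0 < ν₀ ∧ ∀ ν : ℝ, 0 < ν → ν < ν₀ →
    ∃ (N : ℕ) (Φ₁ : Torus.CylindricalTest (Fin 3)) (θ₁ : ℝ), (N : ℝ) ≤ C * ν ^ (-β) ∧
      (∀ i, Torus.fourierTruncate N (Φ₁.g i) = Φ₁.g i) ∧ -Θ ≤ θ₁ ∧ θ₁ ≤ 0 ∧
        ∀ u : H3, FloorIneq ν f Φ₁ θ₁ ε₀ u

/-- `KolmogorovFloor` for a fixed force. -/
def KolmogorovFloorFor (f : 𝕋³ → E³) : Prop := FloorClassFor (3 / 4) f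

/-- The crux is `∃` an admissible force carrying `KolmogorovFloorFor`. (definitional) -/
theorem kolmogorovFloor_iff :
    KolmogorovFloor ↔ ∃ f : 𝕋³ → E³, Torus.IsSmooth f ∧ Torus.IsDivFree f ∧ Torus.HasZeroMean f ∧
      KolmogorovFloorFor f :=
  Iff.rfl

/-! ## §1 Card `dissipate-or-move-transport-dual` -/

/-- Pointwise strain bound of a smooth field: `sup_{x, |η| = 1} |⟪η, (η·∇)W(x)⟫|` (the quantity the
packet lemma prices; `Torus.convect (fun _ => η) W x = (η·∇)W(x)`). Junk `sSup` conventions apply. -/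
def strainSup (W : 𝕋³ → E³) : ℝ :=
  sSup {r : ℝ | ∃ (x : 𝕋³) (η : E³), ‖η‖ = 1 ∧ r = |inner ℝ η (Torus.convect (fun _ => η) W x)|}

/-- The budget unit ball at resolution `N`: admissible multiplier fields of unit strain. -/
def budgetUnitBall (N : ℕ) : Set (𝕋³ → E³) :=
  {W | Torus.IsSmooth W ∧ Torus.IsDivFree W ∧ Torus.HasZeroMean W ∧
    Torus.fourierTruncate N W = W ∧ strainSup W ≤ 1}

/-- The CHEAPEST-STRESS (dual) gauge `‖z‖^*_N := sup {(z, W) : W ∈ budgetUnitBall N}` of an `L²` class —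
the ground cost of the card's transport metric (finite: `(z,W) ≤ ‖z‖‖W‖ ≤ ‖z‖·strain/2π`). -/
def dualGauge (N : ℕ) (z : L2) : ℝ :=
  sSup ((fun W => Torus.pairing z W) '' budgetUnitBall N)

/-- A cylindrical functional is `(N, S)`-BUDGETED if every multiplier field `Φ₁'(u)` is band-limited at
`N` with strain at most `S` — the admissibility of the crux (band limit) plus the packet-lemma pricing
condition `S ≲ (1+2|θ₁|) 4νN²` (PHANTOM-FLOOR §2, ONE-STAGE-PHANTOM §4). -/
def IsBudgeted (Φ₁ : Torus.CylindricalTest (Fin 3)) (N : ℕ) (S : ℝ) : Prop :=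
  ∀ u : H3, Torus.fourierTruncate N (Φ₁.grad u) = Φ₁.grad u ∧ strainSup (Φ₁.grad u) ≤ S

/-- **FIRST LEMMA (card 1).** Budgeted cylindrical functionals are `S`-Lipschitz in the cheapest-stress
gauge: `|Φ₁(u) − Φ₁(v)| ≤ S ‖u − v‖^*_N`. Proof sketch: `t ↦ Φ₁(v + t(u−v))` is `C¹` with derivative
`(u − v, Φ₁'(·))` (chain rule in the finitely many coordinates; `Φ₁'` is the `L²` gradient), and
`Φ₁'(·)/S ∈ budgetUnitBall N`. Provable now (size S–M). -/
def BudgetLipschitz : Prop :=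
  ∀ (Φ₁ : Torus.CylindricalTest (Fin 3)) (N : ℕ) (S : ℝ), 0 ≤ S → IsBudgeted Φ₁ N S →
    ∀ u v : H3, |Φ₁.eval u - Φ₁.eval v| ≤ S * dualGauge N ((u : L2) - (v : L2))

/-- The TRANSPORT DEFECT of a measure `μ` on `H` under `NS_ν(f)` at resolution `N`: the
Kantorovich–Rubinstein-type norm of the Liouville functional `Ψ ↦ ∫⟨F_ν(u), Ψ'(u)⟩ dμ` over
unit-budget cylindrical test functionals — for a flow-transported `μ` this is its `W₁`-speed in the
cheapest-stress ground metric; it vanishes on (relaxed) stationary statistics. -/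
def transportDefect (N : ℕ) (ν : ℝ) (f : 𝕋³ → E³) (μ : Measure H3) : ℝ :=
  sSup {r : ℝ | ∃ Ψ : Torus.CylindricalTest (Fin 3), IsBudgeted Ψ N 1 ∧
    r = ∫ (u : H3), Torus.nsGeneratorPairing ν f u (Ψ.grad u) ∂μ}

/-- **DISSIPATE-OR-MOVE** at `(ν, N, S, Θ, ε₀)` for the force `f`: every Borel probability measure on `H`
carried by the finite-enstrophy part of the Leray ball (with integrable dissipation and work) either
dissipates or moves: `ε₀ ≤ ∫ D dμ + S · transportDefect + 2Θ · ∫ (D − (u,f))⁺-part`.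
This is the card's transfer `C⁺` at one viscosity (the exact Lagrangian dual of a budgeted floor). -/
def DissipateOrMoveAt (ν : ℝ) (N : ℕ) (S Θ ε₀ : ℝ) (f : 𝕋³ → E³) : Prop :=
  ∀ μ : Measure H3, IsProbabilityMeasure μ →
    (∀ᵐ (u : H3) ∂μ, Torus.eGradNormSq ((u : L2) : 𝕋³ → E³) ≠ ⊤ ∧ ‖u‖ ^ 2 ≤ 16 * (∫ x, ‖f x‖ ^ 2) / ν ^ 2) →
    Integrable (fun u : H3 => (Torus.eGradNormSq ((u : L2) : 𝕋³ → E³)).toReal) μ →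
    Integrable (fun u : H3 => Torus.pairing (u : L2) f) μ →
      ε₀ ≤ (∫ (u : H3), ν * (Torus.eGradNormSq ((u : L2) : 𝕋³ → E³)).toReal ∂μ)
            + S * transportDefect N ν f μ
            + 2 * Θ * |∫ (u : H3), (ν * (Torus.eGradNormSq ((u : L2) : 𝕋³ → E³)).toReal - Torus.pairing (u : L2) f) ∂μ|

/-- Weak duality with budget (provable now, modulo `BudgetLipschitz`-type bookkeeping and the scaling
`Φ₁ ↦ Φ₁/S` of cylindrical tests): a budgeted floor certificate at `(ν, N, S)` with weight
`θ₁ ∈ [−Θ, 0]` implies `DissipateOrMoveAt ν N S Θ ε₀ f`. Integrate `FloorIneq` against `μ`. -/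
def WeakDualityWithBudget : Prop :=
  ∀ (ν : ℝ) (N : ℕ) (S Θ ε₀ θ₁ : ℝ) (f : 𝕋³ → E³) (Φ₁ : Torus.CylindricalTest (Fin 3)),
    0 < ν → 0 < S → Torus.IsSmooth f → IsBudgeted Φ₁ N S → -Θ ≤ θ₁ → θ₁ ≤ 0 →
    (∀ u : H3, FloorIneq ν f Φ₁ θ₁ ε₀ u) → DissipateOrMoveAt ν N S Θ ε₀ f

/-- The card's TRANSFER `C⁺` (uniform form): dissipate-or-move along `ν → 0` at Kolmogorov resolution with
budget `S = c (1+2Θ) ν N²`. Equivalent to `KolmogorovFloorFor f` up to the Galerkin reduction (octave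
cross-term compatibility) and finite-dimensional strong duality on the compact Galerkin ball (Sion). -/
def DissipateOrMove (f : 𝕋³ → E³) : Prop :=
  ∃ (ε₀ C Θ c ν₀ : ℝ), 0 < ε₀ ∧ 0 < ν₀ ∧ ∀ ν : ℝ, 0 < ν → ν < ν₀ →
    ∃ N : ℕ, (N : ℝ) ≤ C * ν ^ (-(3 / 4 : ℝ)) ∧
      DissipateOrMoveAt ν N (c * (1 + 2 * Θ) * ν * (N : ℝ) ^ 2) Θ ε₀ f

/-! ## §2 Card `k41-chain-kolmogorov-matching` — the dyadic toy theorem (Mathlib only) -/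

/-- Right-hand side of the viscous dyadic (Katz–Pavlović / Cheskidov) model with intershell ratio
`λ = q³` (so that the K41 weight `λ^{-j/3} = q^{-j}` is a natural power), shell `j ≥ 0`, force on
shell `0`: `ȧ_j = λ^j a_{j−1}² − λ^{j+1} a_j a_{j+1} − ν λ^{2j} a_j + f₀[j = 0]` (`a_{−1} := 0`). -/
def dyadicRHS (q ν f₀ : ℝ) (a : ℕ → ℝ) (j : ℕ) : ℝ :=
  q ^ (3 * j) * (if j = 0 then 0 else a (j - 1)) ^ 2 - q ^ (3 * (j + 1)) * a j * a (j + 1)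
    - ν * q ^ (6 * j) * a j + (if j = 0 then f₀ else 0)

set_option maxHeartbeats 800000 in
/-- **FIRST LEMMA (card 2) — the K41 chain floor for the dyadic model — PROVED (kernel-checked, Mathlib only).**
For the LINEAR certificate `ψ(a) = Σ_{j ≤ J} c q^{−j} a_j` (K41 weights `λ^{-j/3}`, `λ = q³`) truncated at shell
`J`, under the single MATCHING CONDITION `c (q³ + q²) ≤ ν q^{4J}` (i.e. `c(λ + λ^{2/3}) ≤ νλ^{4J/3}`: the flux
out of the last certified shell and the half-slack of the chain are paid by the dissipation of shells `J, J+1`),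
one has for EVERY real state `a : ℕ → ℝ` (no sign condition, no support condition) and every `M ≥ J+1`:
`ν Σ_{j≤M} q^{6j} a_j² + ψ̇(a) ≥ c f₀ − (ν c²/2) q^{4(J+1)}/(q⁴ − 1)`.
With `ν λ^{4J/3} ≍ f₀^{1/2}` (the KOLMOGOROV shell) and `c ≍ f₀^{1/2}` the right side is `≍ f₀^{3/2}`,
INDEPENDENT of `ν`; exact numerics (`toy/dyadic_chain.py`, evidence DYADIC-CHAIN-NUMERICS.md): `inf_a FLOOR =
0.348 … 0.3346` for `ν = 1.2e-2 … 4.7e-9` at `λ = 2, f₀ = 1`, the certified floor peaks exactly at `J ∈ {J_K, J_K+1}`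
and is ν-uniform only for the weight exponent `1/3`.
Proof: split the certificate sum into production / exchange / drift / force channels (reindexing with
`Finset.sum_range_succ'`), AM–GM chain on production vs interior exchange (telescopes to the `a₀²` slack minus
`(c/2)q^{2J+2}a_J²`), AM–GM on the boundary flux and on the viscous drift, capacity of shells `J, J+1` from the
matching condition, geometric sum; the final step is an explicit `linear_combination`. -/
theorem dyadic_chain_floor (q ν f₀ c : ℝ) (J M : ℕ) (hq : 1 < q) (hν : 0 < ν)
    (hc : 0 ≤ c) (hJM : J + 1 ≤ M) (hmatch : c * (q ^ 3 + q ^ 2) ≤ ν * q ^ (4 * J))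
    (a : ℕ → ℝ) :
    c * f₀ - ν * c ^ 2 / 2 * q ^ (4 * (J + 1)) / (q ^ 4 - 1)
      ≤ ν * (∑ j ∈ Finset.range (M + 1), q ^ (6 * j) * a j ^ 2)
        + ∑ j ∈ Finset.range (J + 1), c / q ^ j * dyadicRHS q ν f₀ a j := by
  have hq0 : 0 < q := lt_trans zero_lt_one hq
  have hqne : q ≠ 0 := hq0.ne'
  have hq1 : (1 : ℝ) ≤ q := hq.le
  -- division bookkeeping: c / q^j * q^(j+n) = c * q^n
  have hdiv : ∀ j n : ℕ, c / q ^ j * q ^ (j + n) = c * q ^ n := by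
    intro j n
    rw [pow_add, ← mul_assoc, div_mul_cancel₀ c (pow_ne_zero j hqne)]
  -- Step 1: split the certificate sum into its four channels
  have hsplit : ∀ j : ℕ, c / q ^ j * dyadicRHS q ν f₀ a j
      = c / q ^ j * (q ^ (3 * j) * (if j = 0 then 0 else a (j - 1)) ^ 2)
        - c / q ^ j * (q ^ (3 * (j + 1)) * a j * a (j + 1))
        - c / q ^ j * (ν * q ^ (6 * j) * a j)
        + c / q ^ j * (if j = 0 then f₀ else 0) := by
    intro j; unfold dyadicRHS; ring
  have hprod : ∀ j : ℕ, c / q ^ (j + 1) * (q ^ (3 * (j + 1)) * (if j + 1 = 0 then 0 else a (j + 1 - 1)) ^ 2)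
      = c * q ^ (2 * j + 2) * a j ^ 2 := by
    intro j
    have h1 : ¬ (j + 1 = 0) := by omega
    rw [if_neg h1, Nat.add_sub_cancel]
    have h3 : 3 * (j + 1) = (j + 1) + (2 * j + 2) := by ring
    calc c / q ^ (j + 1) * (q ^ (3 * (j + 1)) * a j ^ 2)
        = (c / q ^ (j + 1) * q ^ ((j + 1) + (2 * j + 2))) * a j ^ 2 := by rw [h3]; ring
      _ = c * q ^ (2 * j + 2) * a j ^ 2 := by rw [hdiv]
  have hexch : ∀ j : ℕ, c / q ^ j * (q ^ (3 * (j + 1)) * a j * a (j + 1)) = c * q ^ (2 * j + 3) * (a j * a (j + 1)) := by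
    intro j
    have h3 : 3 * (j + 1) = j + (2 * j + 3) := by ring
    calc c / q ^ j * (q ^ (3 * (j + 1)) * a j * a (j + 1))
        = (c / q ^ j * q ^ (j + (2 * j + 3))) * (a j * a (j + 1)) := by rw [h3]; ring
      _ = c * q ^ (2 * j + 3) * (a j * a (j + 1)) := by rw [hdiv]
  have hdrift : ∀ j : ℕ, c / q ^ j * (ν * q ^ (6 * j) * a j) = ν * (c * q ^ (5 * j) * a j) := by
    intro j
    have h6 : 6 * j = j + 5 * j := by ring
    calc c / q ^ j * (ν * q ^ (6 * j) * a j) = ν * (c / q ^ j * q ^ (j + 5 * j)) * a j := by rw [h6]; ring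
      _ = ν * (c * q ^ (5 * j)) * a j := by rw [hdiv]
      _ = ν * (c * q ^ (5 * j) * a j) := by ring
  have hfrc : ∀ j : ℕ, c / q ^ (j + 1) * (if j + 1 = 0 then f₀ else 0) = 0 := by
    intro j; simp
  -- the certificate sum, rewritten
  have hcert : ∑ j ∈ range (J + 1), c / q ^ j * dyadicRHS q ν f₀ a j
      = c * f₀ + (∑ j ∈ range J, c * q ^ (2 * j + 2) * a j ^ 2)
        - (∑ j ∈ range (J + 1), c * q ^ (2 * j + 3) * (a j * a (j + 1)))
        - ν * (∑ j ∈ range (J + 1), c * q ^ (5 * j) * a j) := by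
    simp_rw [hsplit]
    rw [sum_add_distrib, sum_sub_distrib, sum_sub_distrib]
    have hP : ∑ j ∈ range (J + 1), c / q ^ j * (q ^ (3 * j) * (if j = 0 then 0 else a (j - 1)) ^ 2)
        = ∑ j ∈ range J, c * q ^ (2 * j + 2) * a j ^ 2 := by
      rw [sum_range_succ']
      simp_rw [hprod]
      simp
    have hF : ∑ j ∈ range (J + 1), c / q ^ j * (if j = 0 then f₀ else 0) = c * f₀ := by
      rw [sum_range_succ']
      simp_rw [hfrc]
      simp
    have hE : ∑ j ∈ range (J + 1), c / q ^ j * (q ^ (3 * (j + 1)) * a j * a (j + 1))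
        = ∑ j ∈ range (J + 1), c * q ^ (2 * j + 3) * (a j * a (j + 1)) := by
      simp_rw [hexch]
    have hD : ∑ j ∈ range (J + 1), c / q ^ j * (ν * q ^ (6 * j) * a j)
        = ν * ∑ j ∈ range (J + 1), c * q ^ (5 * j) * a j := by
      simp_rw [hdrift]; rw [← mul_sum]
    rw [hP, hF, hE, hD]; ring
  rw [hcert]
  -- Step 2: name the sums
  set DJ : ℝ := ∑ j ∈ range J, q ^ (6 * j) * a j ^ 2 with hDJ
  set SQ4 : ℝ := ∑ j ∈ range (J + 1), q ^ (4 * j) with hSQ4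
  have hDJ_nonneg : 0 ≤ DJ := sum_nonneg (fun j _ => mul_nonneg (pow_pos hq0 _).le (sq_nonneg _))
  -- dissipation: restrict to shells ≤ J+1 and peel the last two
  have hdiss : ν * (DJ + q ^ (6 * J) * a J ^ 2 + q ^ (6 * (J + 1)) * a (J + 1) ^ 2)
      ≤ ν * (∑ j ∈ range (M + 1), q ^ (6 * j) * a j ^ 2) := by
    have hsub : range (J + 2) ⊆ range (M + 1) := by
      intro x hx
      simp only [Finset.mem_range] at hx ⊢
      omega
    have h1 : ∑ j ∈ range (J + 2), q ^ (6 * j) * a j ^ 2 ≤ ∑ j ∈ range (M + 1), q ^ (6 * j) * a j ^ 2 :=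
      sum_le_sum_of_subset_of_nonneg hsub (fun j _ _ => mul_nonneg (pow_pos hq0 _).le (sq_nonneg _))
    have h2 : ∑ j ∈ range (J + 2), q ^ (6 * j) * a j ^ 2
        = DJ + q ^ (6 * J) * a J ^ 2 + q ^ (6 * (J + 1)) * a (J + 1) ^ 2 := by
      rw [sum_range_succ, sum_range_succ]
    rw [← h2]
    exact mul_le_mul_of_nonneg_left h1 hν.le
  -- drift channel: AM–GM termwise
  have hdriftb : ν * (∑ j ∈ range (J + 1), c * q ^ (5 * j) * a j)
      ≤ ν / 2 * (DJ + q ^ (6 * J) * a J ^ 2) + ν * c ^ 2 / 2 * SQ4 := by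
    have hterm : ∀ j ∈ range (J + 1), c * q ^ (5 * j) * a j
        ≤ (q ^ (6 * j) * a j ^ 2) / 2 + c ^ 2 / 2 * q ^ (4 * j) := by
      intro j _
      have h5 : q ^ (5 * j) = q ^ (3 * j) * q ^ (2 * j) := by rw [← pow_add]; ring_nf
      have h6 : q ^ (6 * j) = (q ^ (3 * j)) ^ 2 := by rw [← pow_mul]; ring_nf
      have h4 : q ^ (4 * j) = (q ^ (2 * j)) ^ 2 := by rw [← pow_mul]; ring_nf
      rw [h5, h6, h4]
      nlinarith [sq_nonneg (q ^ (3 * j) * a j - c * q ^ (2 * j))]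
    have hs := sum_le_sum hterm
    rw [sum_add_distrib, ← sum_div, ← mul_sum, sum_range_succ (fun j => q ^ (6 * j) * a j ^ 2) J] at hs
    rw [← hDJ, ← hSQ4] at hs
    have h' := mul_le_mul_of_nonneg_left hs hν.le
    have hrw : ν * ((DJ + q ^ (6 * J) * a J ^ 2) / 2 + c ^ 2 / 2 * SQ4)
        = ν / 2 * (DJ + q ^ (6 * J) * a J ^ 2) + ν * c ^ 2 / 2 * SQ4 := by ring
    linarith [h', hrw]
  -- production vs interior exchange
  have hchain : -(c / 2 * q ^ (2 * J + 2) * a J ^ 2)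
      ≤ (∑ j ∈ range J, c * q ^ (2 * j + 2) * a j ^ 2)
          - ∑ j ∈ range J, c * q ^ (2 * j + 3) * (a j * a (j + 1)) := by
    have hterm : ∀ j ∈ range J, c * q ^ (2 * j + 3) * (a j * a (j + 1))
        ≤ c / 2 * (q ^ (2 * j + 2) * a j ^ 2) + c / 2 * (q ^ (2 * (j + 1) + 2) * a (j + 1) ^ 2) := by
      intro j _
      have e3 : q ^ (2 * j + 3) = q ^ (j + 1) * q ^ (j + 2) := by rw [← pow_add]; ring_nf
      have e2 : q ^ (2 * j + 2) = (q ^ (j + 1)) ^ 2 := by rw [← pow_mul]; ring_nf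
      have e4 : q ^ (2 * (j + 1) + 2) = (q ^ (j + 2)) ^ 2 := by rw [← pow_mul]; ring_nf
      rw [e3, e2, e4]
      nlinarith [sq_nonneg (q ^ (j + 1) * a j - q ^ (j + 2) * a (j + 1)), hc,
        mul_nonneg hc (sq_nonneg (q ^ (j + 1) * a j - q ^ (j + 2) * a (j + 1)))]
    have hs := sum_le_sum hterm
    rw [sum_add_distrib, ← mul_sum, ← mul_sum] at hs
    have hshift : ∑ j ∈ range J, q ^ (2 * (j + 1) + 2) * a (j + 1) ^ 2
        = (∑ j ∈ range J, q ^ (2 * j + 2) * a j ^ 2) + q ^ (2 * J + 2) * a J ^ 2 - q ^ 2 * a 0 ^ 2 := by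
      have h := sum_range_succ' (fun j => q ^ (2 * j + 2) * a j ^ 2) J
      simp only [mul_zero, zero_add] at h
      rw [sum_range_succ] at h
      linarith
    rw [hshift] at hs
    have hsum_eq : ∑ j ∈ range J, c * q ^ (2 * j + 2) * a j ^ 2
        = c * ∑ j ∈ range J, q ^ (2 * j + 2) * a j ^ 2 := by
      rw [mul_sum]; exact sum_congr rfl (fun j _ => by ring)
    rw [hsum_eq]
    have ha0 : 0 ≤ c * (q ^ 2 * a 0 ^ 2) := mul_nonneg hc (mul_nonneg (pow_pos hq0 2).le (sq_nonneg _))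
    linarith [hs, ha0]
  -- boundary exchange (j = J)
  have hexch_split : ∑ j ∈ range (J + 1), c * q ^ (2 * j + 3) * (a j * a (j + 1))
      = (∑ j ∈ range J, c * q ^ (2 * j + 3) * (a j * a (j + 1)))
          + c * q ^ (2 * J + 3) * (a J * a (J + 1)) := by
    rw [sum_range_succ]
  have hbdry : c * q ^ (2 * J + 3) * (a J * a (J + 1))
      ≤ c / 2 * q ^ (2 * J + 3) * a J ^ 2 + c / 2 * q ^ (2 * J + 3) * a (J + 1) ^ 2 := by
    have hcq : 0 ≤ c * q ^ (2 * J + 3) := mul_nonneg hc (pow_pos hq0 _).le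
    nlinarith [mul_nonneg hcq (sq_nonneg (a J - a (J + 1)))]
  -- matching: capacities of shells J and J+1
  have hcap : c * q ^ (2 * J + 3) + c * q ^ (2 * J + 2) ≤ ν * q ^ (6 * J) := by
    have h1 : c * (q ^ 3 + q ^ 2) * q ^ (2 * J) ≤ ν * q ^ (4 * J) * q ^ (2 * J) :=
      mul_le_mul_of_nonneg_right hmatch (pow_pos hq0 _).le
    have e1 : q ^ (4 * J) * q ^ (2 * J) = q ^ (6 * J) := by rw [← pow_add]; ring_nf
    have e2 : q ^ 3 * q ^ (2 * J) = q ^ (2 * J + 3) := by rw [← pow_add]; ring_nf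
    have e3 : q ^ 2 * q ^ (2 * J) = q ^ (2 * J + 2) := by rw [← pow_add]; ring_nf
    have hl : c * (q ^ 3 + q ^ 2) * q ^ (2 * J) = c * q ^ (2 * J + 3) + c * q ^ (2 * J + 2) := by
      rw [← e2, ← e3]; ring
    have hr : ν * q ^ (4 * J) * q ^ (2 * J) = ν * q ^ (6 * J) := by rw [mul_assoc, e1]
    linarith [h1, hl, hr]
  have hcapJ1 : c / 2 * q ^ (2 * J + 3) ≤ ν * q ^ (6 * (J + 1)) := by
    have h3 : q ^ (6 * J) ≤ q ^ (6 * (J + 1)) := pow_le_pow_right₀ hq1 (by omega)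
    have h4 : 0 ≤ c * q ^ (2 * J + 2) := mul_nonneg hc (pow_pos hq0 _).le
    have h5 : 0 ≤ c * q ^ (2 * J + 3) := mul_nonneg hc (pow_pos hq0 _).le
    have h6 : ν * q ^ (6 * J) ≤ ν * q ^ (6 * (J + 1)) := mul_le_mul_of_nonneg_left h3 hν.le
    linarith [hcap, h4, h5, h6]
  -- geometric sum
  have hgeom : SQ4 ≤ q ^ (4 * (J + 1)) / (q ^ 4 - 1) := by
    have hq4 : (1 : ℝ) < q ^ 4 := one_lt_pow₀ hq (by norm_num)
    have hne : q ^ 4 ≠ 1 := hq4.ne'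
    have hS : SQ4 = ∑ j ∈ range (J + 1), (q ^ 4) ^ j := by
      rw [hSQ4]; exact sum_congr rfl (fun j _ => by rw [← pow_mul])
    rw [hS, geom_sum_eq hne, ← pow_mul]
    have hpos : 0 < q ^ 4 - 1 := by linarith
    exact div_le_div_of_nonneg_right (by linarith [pow_pos hq0 (4 * (J + 1))]) hpos.le
  -- leftover shell coefficients, multiplied by the squares
  have hcap' : c / 2 * q ^ (2 * J + 2) + c / 2 * q ^ (2 * J + 3) ≤ ν / 2 * q ^ (6 * J) := by
    linarith [hcap]
  have hA := mul_le_mul_of_nonneg_right hcap' (sq_nonneg (a J))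
  have hB := mul_le_mul_of_nonneg_right hcapJ1 (sq_nonneg (a (J + 1)))
  have hνc : 0 ≤ ν * c ^ 2 / 2 := by positivity
  have hG : ν * c ^ 2 / 2 * SQ4 ≤ ν * c ^ 2 / 2 * (q ^ (4 * (J + 1)) / (q ^ 4 - 1)) :=
    mul_le_mul_of_nonneg_left hgeom hνc
  have hνDJ : 0 ≤ ν * DJ := mul_nonneg hν.le hDJ_nonneg
  -- combine (everything is now linear in the named atoms)
  rw [hexch_split]
  linear_combination hdiss + hdriftb + hchain + hbdry + hA + hB + hG + (1 / 2 : ℝ) * hνDJ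

/-! ## §3 Memo `WARM-RANGE-RAY.md` — a new necessary condition on the witness force -/

/-- `v` is a smooth solenoidal mean-zero STEADY EULER field on `T³` (own pressure): `P[(v·∇)v] = 0`,
tested weakly against smooth solenoidal mean-zero fields. Every parallel shear on a lattice line, every
Beltrami field, every `2½`-D Arnold flow qualifies. -/
def IsSteadyEulerField (v : 𝕋³ → E³) : Prop :=
  Torus.IsSmooth v ∧ Torus.IsDivFree v ∧ Torus.HasZeroMean v ∧
    ∀ w : 𝕋³ → E³, Torus.IsSmooth w → Torus.IsDivFree w → Torus.HasZeroMean w →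
      ∫ x, inner ℝ (Torus.convect v v x) (w x) = 0

/-- `f` is a LINEARIZED DESIGNER FORCE: `f = P[(v·∇)g + (g·∇)v] = D B(v)[g]` weakly, for a non-zero
steady Euler field `v` and a smooth solenoidal mean-zero `g` — a "quiet Euler point at infinity":
`B(s v + g/s, s v + g/s) = f + B(g,g)/s² → f` as `s → ∞`. -/
def IsLinearizedDesignerForce (f : 𝕋³ → E³) : Prop :=
  ∃ v g : 𝕋³ → E³, IsSteadyEulerField v ∧ (∃ x, v x ≠ 0) ∧
    Torus.IsSmooth g ∧ Torus.IsDivFree g ∧ Torus.HasZeroMean g ∧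
    ∀ w : 𝕋³ → E³, Torus.IsSmooth w → Torus.IsDivFree w → Torus.HasZeroMean w →
      ∫ x, inner ℝ (Torus.convect v g x + Torus.convect g v x - f x) (w x) = 0

/-- **WARM RANGE-RAY KILL** (paper theorem of `WARM-RANGE-RAY.md`, typed target for rattack/cdisprove):
for a linearized designer force the warm ray `a_ν = ν^{-1/3} v + ν^{1/3} g` is an admissible smooth state
of the Leray ball with `ν‖∇a_ν‖² = O(ν^{1/3})`, `(a_ν, f) = O(ν^{1/3})` and residual
`F_ν(a_ν) = −ν^{2/3} A v − ν^{4/3} A g − ν^{2/3} B(g,g)` of size `O(ν^{2/3})` in the `ℓ¹`-weighted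
`H⁻¹` norm; a Kolmogorov-class floor at `a_ν` therefore needs a resolved coefficient
`|q|‖Ŵ(q)‖ ≳ ε₀ ν^{-2/3}`, which the coords-invisible two-wave beat above `N` (price
`≲ 40π²(1+2Θ)C² ν^{-1/2}` per unit energy at `β = 3/4`) converts into a violation at `a_ν + t w`,
`t² ≍ ν^{2/3}`. Hence `¬ KolmogorovFloorFor f` — indeed every band-limited class with `N = o(ν^{-5/6})`
dies for such `f`, with ν-uniform weights. -/
def WarmRangeRayKill : Prop :=
  ∀ f : 𝕋³ → E³, Torus.IsSmooth f → IsLinearizedDesignerForce f → ¬ KolmogorovFloorFor f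

/-- The NEW NECESSARY CONDITION on the witness force of the crux (logic, proved): under the kill, any
witness `f` of `KolmogorovFloor` is NOT a linearized designer force. -/
theorem witness_not_linearizedDesigner (hK : WarmRangeRayKill) (h : KolmogorovFloor) :
    ∃ f : 𝕋³ → E³, Torus.IsSmooth f ∧ Torus.IsDivFree f ∧ Torus.HasZeroMean f ∧
      ¬ IsLinearizedDesignerForce f ∧ KolmogorovFloorFor f := by
  obtain ⟨f, hs, hd, hz, hF⟩ := kolmogorovFloor_iff.mp h
  exact ⟨f, hs, hd, hz, fun hL => hK f hs hL hF, hF⟩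

/-- Conversely the crux is untouched as a statement: it only acquires the design rule
`¬ IsLinearizedDesignerForce f` for its witness (recorded for the tenure planner's "which f"). -/
theorem kolmogorovFloor_of_witness {f : 𝕋³ → E³} (hs : Torus.IsSmooth f) (hd : Torus.IsDivFree f)
    (hz : Torus.HasZeroMean f) (hF : KolmogorovFloorFor f) : KolmogorovFloor :=
  kolmogorovFloor_iff.mpr ⟨f, hs, hd, hz, hF⟩

end Summit.AnomalousDissipation.AnomalousDissipation.Cruxes.KolmogorovFloor.Ideator2
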